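import Summits.QuantumFields.BalabanUV.Beta.GAN24.AlmostNestedFirstOrderEnd
import Summits.QuantumFields.BalabanUV.Beta.GAN24.PlantedTwoWordDefectLaw
import Summits.QuantumFields.BalabanUV.Beta.GAN24.NestedTwoVertexWordRate

/-!
# `BalabanUV.Beta.GAN24.AlmostNestedTwoVertexWordRate` — binder row G-an2-4 ∕ (CONV-C), routes C-R6° («VALUES») × R7 («TWO CURRENCIES»), PART 234:
# CENSUS V204′ (ii), THE TWO-VERTEX WORD — `𝒢P_i𝒢P_j𝒢` OF TWO BOUNDED ALMOST NESTED SINGLE-DIRECTION BACKGROUNDS CONVERGES ALONG BAŁABAN's TOWER AT RATIO `√(L⁻¹)` IN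
# OPERATOR NORM, AND HAS THE THREE-POINT ENVELOPES (UD)+(SR) AT RATIO `L^{−1∕4}`: PART 233's two defect letters are small because BOTH items of (1.89) smooth sheets —
# `‖𝒢·𝟙_{slab}‖` (PART 226) AND `‖∇_μ𝒢·𝟙_{slab}‖ ≤ Cst√(3m)·(√(L⁻¹))^k` (here, from `‖𝒢∇ᴴ‖, ‖∇𝒢∇ᴴ‖ ≤ Cst`) (unit b2b-balaban-gan24-p3, gen 64; v1)

NOT IN PRINT; OUR PROOF ([folklore] bookkeeping BY NAME over PART 226 (`nsq_slab_le`, `opNorm_calGlev_mul_slab_le`), PART 228 (`JK_conjTranspose_mul_diagonal_mul_JK`,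
`opNorm_mul_diagonal_le_of_slabs`), PART 233 (`towerLimitRate_plantedTwoWordDefect`), PART 222's shape, PART 204 (`exists_threePoint_twoVertexWord`), PART 218's letters, [B5] (1.89)
(`opNorm_calG_star_fdiff_le`, `opNorm_fdiff_calG_star_fdiff_le`); [Balaban1984PropagatorsI] Prop. 1.1 (1.89) p. 33 the only printed estimate; nothing printed is a hypothesis).
HONEST FRAMING (cell contract, verbatim): «discharging `BetaPertH` makes Bałaban's UV stability UNCONDITIONAL — a real constructive-QFT result; it is NOT the
continuum limit and NOT the Clay problem.»  HONEST DEPENDENCY (verbatim): «continuum YM on T⁴ ⇐ BetaPertH ∧ nine spine estimates (0/9 proved); BetaPertH ⇐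
(D1) ∧ (D4) ∧ CAP+tail; G-an2-4 gates asym, D1 and NE2/3/4.»

WHAT THIS FILE PROVES (0 sorry, 0 `def`):
* §1 **`opNorm_slab_mul_le_of_bounds`** (generic: `‖B‖ ≤ C`, `‖∇_νB‖ ≤ C` ⟹ `‖𝟙_A·B‖ ≤ C√(3·#A∕n)`), **`opNorm_fdiff_calG_mul_slab_le`** (`‖∇_μ𝒢·𝟙_A‖ ≤ Cst√(3·#A∕n)`),
  **`opNorm_fdiff_calGlev_mul_slab_le`** (tower reading, ratio `√(L⁻¹)`); the two DEFECT LETTERS of an almost nested family: **`defect_calGlev_le`** (`‖𝒢_k·diag(blockavg V^{(k+1)} −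
  V^{(k)})‖`) and **`defect_fdiff_calGlev_le`** (`‖∇_μ𝒢_k·diag(…)‖`), both `≤ d·Cst√(3m)·2α·(√(L⁻¹))^k`.
* §2 **`towerLimitRate_almostNestedTwoWord`** — `TowerLimitRate (QBlev) (L^d) (k ↦ 𝒢_kP_{1,k}𝒢_kP_{2,k}𝒢_k) C √(L⁻¹)` for two bounded almost nested single-direction families.
* §3 **`exists_threePoint_twoVertexWord_rate_almostNested`** — `∃ κ > 0, B, B′ ≥ 0` (volume-free; directions and slab families quantified inside): PART 204 §3's three-point (UD)
  and the step envelope `B′·(√(√(L⁻¹)))^k·e^{−κD}`.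
WHAT IT DOES NOT DO: the tadpole traces and the ENDs (PART 235).  SUPPLIER work; NEVER «G-an2-4 closed»; NOT (CONV-C), NOT D1, NOT `BetaPertH`, NOT continuum, NOT Clay.
Records: `HOME/b2b-balaban-gan24-p3/gen64/README.md`.
-/

noncomputable section

open scoped BigOperators ComplexConjugate Matrix Matrix.Norms.L2Operator
open Filter Topology Finset

namespace Summit.QuantumFields.BalabanUV.Beta.GAN24.AlmostNestedTwoVertexWordRate

open Literature.MathematicalPhysics.QuantumFieldTheory.Balaban1983to89
open Literature.MathematicalPhysics.QuantumFieldTheory.Balaban1983to89.B5Prop11Plancherel (Tor fine Cst Cst_nonneg shiftM fdiff calG opNorm_calG_le opNorm_fdiff_calG_le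
  opNorm_calG_star_fdiff_le opNorm_fdiff_calG_star_fdiff_le calG_isHermitian)
open Literature.MathematicalPhysics.QuantumFieldTheory.Balaban1983to89.B5Prop11Lower (nsq nsq_nonneg)
open Literature.MathematicalPhysics.QuantumFieldTheory.Balaban1983to89.B5G183RateTorusW (CQL)
open Literature.MathematicalPhysics.QuantumFieldTheory.Balaban1983to89.B5G183RateUnitTower (lev)
open Summit.QuantumFields.BalabanUV.T4Continuum
open Summit.QuantumFields.BalabanUV.T4Continuum.CovariantAveragingTower (avgTow TowerLimitRate)
open Summit.QuantumFields.BalabanUV.T4Continuum.BalabanAveragedTowerUnit (idx QBlev calGlev one_le_lev' cast_lev')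
open Summit.QuantumFields.BalabanUV.T4Continuum.BalabanAveragingPairing (FQBlev freeTowerLaws_balaban)
open Summit.QuantumFields.BalabanUV.T4Continuum.KingPairingPlantedLaw (JK JpcT calDalev calDalev_inv CJ CJ_nonneg)
open Summit.QuantumFields.BalabanUV.T4Continuum.BlockPairingGeometry (parT opNorm_diagonal_le)
open Summit.QuantumFields.BalabanUV.T4Continuum.FirstOrderBackgroundModel (Pmodel)
open Summit.QuantumFields.BalabanUV.T4Continuum.CTKingTowerWeights (rho distK)
open Summit.QuantumFields.BalabanUV.T4Continuum.DecayRateInterpolation (EntryDecay TwoLevelDecayRate decayRate_of_towerLimitRate)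
open Summit.QuantumFields.BalabanUV.T4Continuum.ScalarAveragedPropagator (opNorm_le_of_nsq_le_rect)
open Summit.QuantumFields.BalabanUV.T4Continuum.GaugeTermCoercivity (nsq_mulVec_le_rect)
open Summit.QuantumFields.BalabanUV.Beta.GAN24.UnitLatticeDecayAlgebra (distK_nonneg)
open Summit.QuantumFields.BalabanUV.Beta.GAN24.TwoVertexWordThreePointDecay (exists_threePoint_twoVertexWord)
open Summit.QuantumFields.BalabanUV.Beta.GAN24.DerivativeItemPlantedLaw (plantedG_le_lev plantedW_le_lev pairingW_le_lev)
open Summit.QuantumFields.BalabanUV.Beta.GAN24.NestedBackgroundWordRate (Pmodel_single)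
open Summit.QuantumFields.BalabanUV.Beta.GAN24.SlabSmoothingBound (nsq_slab_le shiftM_sub_one_eq opNorm_calGlev_mul_slab_le)
open Summit.QuantumFields.BalabanUV.Beta.GAN24.AlmostNestedWordRate (JK_conjTranspose_mul_diagonal_mul_JK opNorm_mul_diagonal_le_of_slabs)
open Summit.QuantumFields.BalabanUV.Beta.GAN24.PlantedTwoWordDefectLaw (towerLimitRate_plantedTwoWordDefect)

variable {d : ℕ} (L : ℕ) [NeZero L]

/-! ## §1 The derivative item smooths sheets too; the two defect letters of an almost nested family -/

section Slab

variable (n : ℕ) [NeZero n] (hn : 1 ≤ n) (M : Fin d → ℕ) [hM : ∀ μ, NeZero (M μ)] (a : ℝ) (ha : 0 < a)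

omit [NeZero L] in
/-- **`opNorm_slab_mul_le_of_bounds`** — PART 226 §3 for ANY matrix `B` with `‖B‖ ≤ C` and `‖∇_ν B‖ ≤ C`: `‖𝟙_A·B‖ ≤ C·√(3·#A∕n)` (slab `A` of residues mod `n·M_ν`
transverse to `ν`). [cite: Balaban1984PropagatorsI, Prop. 1.1 (1.89) p.33 (the two bounds it is used with)] [folklore] -/
theorem opNorm_slab_mul_le_of_bounds (ν : Fin d) (A : Finset (ZMod (fine n M ν))) (B : Matrix (Tor (fine n M) × Fin d) (Tor (fine n M) × Fin d) ℂ) {C : ℝ} (hC : 0 ≤ C)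
    (hB : ‖B‖ ≤ C) (hB' : ‖fdiff (fine n M) (n : ℂ) ν * B‖ ≤ C) :
    ‖Matrix.diagonal (fun w : Tor (fine n M) × Fin d => if w.1 ν ∈ A then (1 : ℂ) else 0) * B‖ ≤ C * Real.sqrt (3 * A.card / n) := by
  have hn0 : (0 : ℝ) < n := by exact_mod_cast Nat.pos_of_ne_zero (NeZero.ne n)
  have hNν : (n : ℝ) ≤ (fine n M ν : ℕ) := by
    have h1 : 1 ≤ M ν := Nat.pos_of_ne_zero (NeZero.ne _)
    have : n * 1 ≤ n * M ν := Nat.mul_le_mul_left n h1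
    exact_mod_cast (by simpa using this : n ≤ n * M ν)
  refine opNorm_le_of_nsq_le_rect _ (mul_nonneg hC (Real.sqrt_nonneg _)) fun g => ?_
  set u := B *ᵥ g with hu
  have e1 : nsq ((Matrix.diagonal (fun w : Tor (fine n M) × Fin d => if w.1 ν ∈ A then (1 : ℂ) else 0) * B) *ᵥ g)
      = ∑ w ∈ univ.filter (fun w : Tor (fine n M) × Fin d => w.1 ν ∈ A), ‖u w‖ ^ 2 := by
    rw [← Matrix.mulVec_mulVec, ← hu]
    unfold nsq
    simp only [Matrix.mulVec_diagonal]
    rw [sum_filter]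
    refine sum_congr rfl fun w _ => ?_
    split_ifs <;> simp
  rw [e1]
  have hu1 : nsq u ≤ C ^ 2 * nsq g :=
    (nsq_mulVec_le_rect _ g).trans (mul_le_mul_of_nonneg_right (pow_le_pow_left₀ (norm_nonneg _) hB 2) (nsq_nonneg g))
  have hu2 : nsq (shiftM (fine n M) ν *ᵥ u - u) ≤ (C / n) ^ 2 * nsq g := by
    have e : shiftM (fine n M) ν *ᵥ u - u = (((n : ℂ))⁻¹ • (fdiff (fine n M) (n : ℂ) ν * B)) *ᵥ g := by
      rw [← Matrix.smul_mul, ← shiftM_sub_one_eq, Matrix.sub_mul, Matrix.one_mul, Matrix.sub_mulVec, ← Matrix.mulVec_mulVec]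
    rw [e]
    refine (nsq_mulVec_le_rect _ g).trans (mul_le_mul_of_nonneg_right ?_ (nsq_nonneg g))
    have h1 : ‖((n : ℂ))⁻¹ • (fdiff (fine n M) (n : ℂ) ν * B)‖ ≤ C / n := by
      rw [norm_smul, norm_inv, Complex.norm_natCast, div_eq_inv_mul]
      exact mul_le_mul_of_nonneg_left hB' (inv_nonneg.mpr hn0.le)
    exact pow_le_pow_left₀ (norm_nonneg _) h1 2
  have hg0 := nsq_nonneg g
  have s1 : Real.sqrt (nsq u) ≤ C * Real.sqrt (nsq g) := by
    rw [← Real.sqrt_sq hC, ← Real.sqrt_mul (sq_nonneg _)]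
    exact Real.sqrt_le_sqrt hu1
  have s2 : Real.sqrt (nsq (shiftM (fine n M) ν *ᵥ u - u)) ≤ (C / n) * Real.sqrt (nsq g) := by
    rw [← Real.sqrt_sq (div_nonneg hC hn0.le), ← Real.sqrt_mul (sq_nonneg _)]
    exact Real.sqrt_le_sqrt hu2
  have h := nsq_slab_le (fine n M) ν A u
  have hA : (0 : ℝ) ≤ A.card := Nat.cast_nonneg _
  have t1 : nsq u / (fine n M ν : ℕ) ≤ C ^ 2 * nsq g / n :=
    calc nsq u / (fine n M ν : ℕ) ≤ nsq u / n := div_le_div_of_nonneg_left (nsq_nonneg u) hn0 hNν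
      _ ≤ C ^ 2 * nsq g / n := div_le_div_of_nonneg_right hu1 hn0.le
  have t2 : 2 * Real.sqrt (nsq (shiftM (fine n M) ν *ᵥ u - u)) * Real.sqrt (nsq u) ≤ 2 * ((C / n) * Real.sqrt (nsq g)) * (C * Real.sqrt (nsq g)) :=
    mul_le_mul (mul_le_mul_of_nonneg_left s2 zero_le_two) s1 (Real.sqrt_nonneg _) (by positivity)
  have t3 : Real.sqrt (nsq g) * Real.sqrt (nsq g) = nsq g := Real.mul_self_sqrt hg0
  calc ∑ w ∈ univ.filter (fun w : Tor (fine n M) × Fin d => w.1 ν ∈ A), ‖u w‖ ^ 2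
      ≤ A.card * (nsq u / (fine n M ν : ℕ) + 2 * Real.sqrt (nsq (shiftM (fine n M) ν *ᵥ u - u)) * Real.sqrt (nsq u)) := h
    _ ≤ A.card * (C ^ 2 * nsq g / n + 2 * ((C / n) * Real.sqrt (nsq g)) * (C * Real.sqrt (nsq g))) :=
        mul_le_mul_of_nonneg_left (add_le_add t1 t2) hA
    _ = (C * Real.sqrt (3 * A.card / n)) ^ 2 * nsq g := by
        rw [mul_pow, Real.sq_sqrt (by positivity)]
        have e3 : 2 * ((C / n) * Real.sqrt (nsq g)) * (C * Real.sqrt (nsq g)) = 2 * C ^ 2 * nsq g / n := by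
          calc 2 * ((C / n) * Real.sqrt (nsq g)) * (C * Real.sqrt (nsq g))
              = 2 * C ^ 2 * (Real.sqrt (nsq g) * Real.sqrt (nsq g)) / n := by ring
            _ = 2 * C ^ 2 * nsq g / n := by rw [t3]
        rw [e3]; field_simp; ring

omit [NeZero L] in
/-- **`opNorm_fdiff_calG_mul_slab_le` — THE DERIVATIVE ITEM SMOOTHS SHEETS**: `‖∇_μ𝒢·𝟙_A‖ ≤ Cst(d,a)·√(3·#A∕n)` — `(∇_μ𝒢·𝟙_A)ᴴ = 𝟙_A·𝒢∇_μᴴ` and §1's generic bound with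
`B = 𝒢∇_μᴴ` (`‖𝒢∇ᴴ‖, ‖∇𝒢∇ᴴ‖ ≤ Cst`, (1.89)). [cite: Balaban1984PropagatorsI, Prop. 1.1 (1.89) p.33] -/
theorem opNorm_fdiff_calG_mul_slab_le (μ ν : Fin d) (A : Finset (ZMod (fine n M ν))) :
    ‖fdiff (fine n M) (n : ℂ) μ * calG n hn M a ha * Matrix.diagonal (fun w : Tor (fine n M) × Fin d => if w.1 ν ∈ A then (1 : ℂ) else 0)‖
      ≤ Cst d a * Real.sqrt (3 * A.card / n) := by
  have hC : 0 ≤ Cst d a := (norm_nonneg _).trans (opNorm_calG_le n hn M a ha)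
  have hD : (Matrix.diagonal (fun w : Tor (fine n M) × Fin d => if w.1 ν ∈ A then (1 : ℂ) else 0))ᴴ
      = Matrix.diagonal (fun w : Tor (fine n M) × Fin d => if w.1 ν ∈ A then (1 : ℂ) else 0) := by
    rw [Matrix.diagonal_conjTranspose]
    congr 1; funext w; by_cases h : w.1 ν ∈ A <;> simp [h]
  have e : fdiff (fine n M) (n : ℂ) μ * calG n hn M a ha * Matrix.diagonal (fun w : Tor (fine n M) × Fin d => if w.1 ν ∈ A then (1 : ℂ) else 0)
      = (Matrix.diagonal (fun w : Tor (fine n M) × Fin d => if w.1 ν ∈ A then (1 : ℂ) else 0) * (calG n hn M a ha * star (fdiff (fine n M) (n : ℂ) μ)))ᴴ := by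
    rw [Matrix.conjTranspose_mul, hD, Matrix.conjTranspose_mul, Matrix.star_eq_conjTranspose, Matrix.conjTranspose_conjTranspose, (calG_isHermitian n hn M a ha).eq,
      Matrix.mul_assoc]
  rw [e, Matrix.l2_opNorm_conjTranspose]
  refine opNorm_slab_mul_le_of_bounds n M ν A _ hC (opNorm_calG_star_fdiff_le n hn M a ha μ) ?_
  rw [← Matrix.mul_assoc]
  exact opNorm_fdiff_calG_star_fdiff_le n hn M a ha ν μ

end Slab

section TowerSlab

variable (M : Fin d → ℕ) [hM : ∀ μ, NeZero (M μ)] (a : ℝ) (ha : 0 < a)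

/-- **`opNorm_fdiff_calGlev_mul_slab_le` — ALONG THE TOWER**: `‖∇_μ𝒢_k·𝟙_A‖ ≤ Cst(d,a)·√(3·#A)·(√(L⁻¹))^k`. [cite: Balaban1984PropagatorsI, Prop. 1.1 (1.89) p.33] -/
theorem opNorm_fdiff_calGlev_mul_slab_le (k : ℕ) (μ ν : Fin d) (A : Finset (ZMod (fine (lev L k) M ν))) :
    ‖fdiff (fine (lev L k) M) ((lev L k : ℕ) : ℂ) μ * calGlev L M a ha k * Matrix.diagonal (fun w : idx L M k => if w.1 ν ∈ A then (1 : ℂ) else 0)‖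
      ≤ Cst d a * Real.sqrt (3 * A.card) * Real.sqrt ((L : ℝ)⁻¹) ^ k := by
  have h := opNorm_fdiff_calG_mul_slab_le (lev L k) (one_le_lev' L k) M a ha μ ν A
  have hL : (0 : ℝ) ≤ (L : ℝ)⁻¹ := inv_nonneg.mpr (Nat.cast_nonneg L)
  have e2 : Real.sqrt (((L : ℝ)⁻¹) ^ k) = Real.sqrt ((L : ℝ)⁻¹) ^ k := by
    rw [← Real.sqrt_sq (pow_nonneg (Real.sqrt_nonneg _) k), ← pow_mul, mul_comm, pow_mul, Real.sq_sqrt hL]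
  have e : Real.sqrt (3 * A.card / (lev L k : ℕ)) = Real.sqrt (3 * A.card) * Real.sqrt ((L : ℝ)⁻¹) ^ k := by
    rw [cast_lev', div_eq_mul_inv, ← inv_pow, Real.sqrt_mul (by positivity), e2]
  rw [e, ← mul_assoc] at h
  exact h

/-- **`defect_calGlev_le` — THE FIRST DEFECT LETTER OF AN ALMOST NESTED FAMILY**: `‖𝒢_k·(J_kᴴ·diag(V^{(k+1)}_{μ₀})·J_k − diag(V^{(k)}_{μ₀}))‖ ≤ d·(Cst√(3m))·2α·(√(L⁻¹))^k`
(PART 228 §1–§2 + PART 226; the inline letter of PART 228 §3 made reusable). [folklore] -/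
theorem defect_calGlev_le {α : ℝ} (hα : 0 ≤ α) {m : ℕ} {V : (k : ℕ) → Fin d → (idx L M k → ℂ)} {μ₀ : Fin d}
    (hVb : ∀ k μ u, ‖V k μ u‖ ≤ α) (A : (k : ℕ) → (ν : Fin d) → Finset (ZMod (fine (lev L k) M ν))) (hA : ∀ k ν, (A k ν).card ≤ m)
    (hdef : ∀ k (u : idx L M k), (∀ ν, u.1 ν ∉ A k ν) →
      ((L : ℂ) ^ d)⁻¹ * ∑ x ∈ univ.filter (fun x : idx L M (k + 1) => parT (lev L k) L M x = u), V (k + 1) μ₀ x = V k μ₀ u) (k : ℕ) :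
    ‖calGlev L M a ha k * ((JpcT L M k)ᴴ * Matrix.diagonal (V (k + 1) μ₀) * JpcT L M k - Matrix.diagonal (V k μ₀))‖
      ≤ (d * (Cst d a * Real.sqrt (3 * m)) * (2 * α)) * Real.sqrt ((L : ℝ)⁻¹) ^ k := by
  have hCst := Cst_nonneg d a
  have hfree := freeTowerLaws_balaban L M a ha
  have hE : (JpcT L M k)ᴴ * Matrix.diagonal (V (k + 1) μ₀) * JpcT L M k - Matrix.diagonal (V k μ₀)
      = Matrix.diagonal (fun u : idx L M k => ((L : ℂ) ^ d)⁻¹ * ∑ x ∈ univ.filter (fun x : idx L M (k + 1) => parT (lev L k) L M x = u), V (k + 1) μ₀ x - V k μ₀ u) := by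
    have h1 : (JpcT L M k)ᴴ * Matrix.diagonal (V (k + 1) μ₀) * JpcT L M k
        = Matrix.diagonal (fun u : idx L M k => ((L : ℂ) ^ d)⁻¹ * ∑ x ∈ univ.filter (fun x : idx L M (k + 1) => parT (lev L k) L M x = u), V (k + 1) μ₀ x) :=
      JK_conjTranspose_mul_diagonal_mul_JK M (lev L k) L (V (k + 1) μ₀)
    rw [h1, Matrix.diagonal_sub]
  have hEn : ‖(JpcT L M k)ᴴ * Matrix.diagonal (V (k + 1) μ₀) * JpcT L M k - Matrix.diagonal (V k μ₀)‖ ≤ 2 * α := by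
    refine (norm_sub_le _ _).trans ?_
    have h1 : ‖(JpcT L M k)ᴴ * Matrix.diagonal (V (k + 1) μ₀) * JpcT L M k‖ ≤ α := by
      have hJ := hfree.opNorm_J_le k
      have hJ' : ‖(JpcT L M k)ᴴ‖ ≤ 1 := by rw [Matrix.l2_opNorm_conjTranspose]; exact hJ
      calc _ ≤ ‖(JpcT L M k)ᴴ * Matrix.diagonal (V (k + 1) μ₀)‖ * ‖JpcT L M k‖ := Matrix.l2_opNorm_mul _ _
        _ ≤ (‖(JpcT L M k)ᴴ‖ * ‖Matrix.diagonal (V (k + 1) μ₀)‖) * 1 := mul_le_mul (Matrix.l2_opNorm_mul _ _) hJ (norm_nonneg _) (mul_nonneg (norm_nonneg _) (norm_nonneg _))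
        _ ≤ (1 * α) * 1 := mul_le_mul_of_nonneg_right (mul_le_mul hJ' (opNorm_diagonal_le (fine (lev L (k + 1)) M) hα fun u => hVb (k + 1) μ₀ u) (norm_nonneg _) zero_le_one) zero_le_one
        _ = α := by ring
    have h2 : ‖Matrix.diagonal (V k μ₀)‖ ≤ α := opNorm_diagonal_le (fine (lev L k) M) hα fun u => hVb k μ₀ u
    linarith
  have hs : ∀ ν, ‖calGlev L M a ha k * Matrix.diagonal (fun w : idx L M k => if w.1 ν ∈ A k ν then (1 : ℂ) else 0)‖ ≤ Cst d a * Real.sqrt (3 * m) * Real.sqrt ((L : ℝ)⁻¹) ^ k := by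
    intro ν
    refine (opNorm_calGlev_mul_slab_le L M a ha k ν (A k ν)).trans (mul_le_mul_of_nonneg_right (mul_le_mul_of_nonneg_left (Real.sqrt_le_sqrt ?_) hCst) (pow_nonneg (Real.sqrt_nonneg _) k))
    exact_mod_cast Nat.mul_le_mul_left 3 (hA k ν)
  have he : ∀ w : idx L M k, (((L : ℂ) ^ d)⁻¹ * ∑ x ∈ univ.filter (fun x : idx L M (k + 1) => parT (lev L k) L M x = w), V (k + 1) μ₀ x - V k μ₀ w) ≠ 0 → ∃ ν, w.1 ν ∈ A k ν := by
    intro w hw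
    by_contra hne
    exact hw (sub_eq_zero.mpr (hdef k w fun ν hν => hne ⟨ν, hν⟩))
  rw [hE]
  refine (opNorm_mul_diagonal_le_of_slabs M (calGlev L M a ha k) (A k) (by positivity) hs _ he).trans ?_
  rw [← hE]
  calc (d : ℝ) * (Cst d a * Real.sqrt (3 * m) * Real.sqrt ((L : ℝ)⁻¹) ^ k) * ‖(JpcT L M k)ᴴ * Matrix.diagonal (V (k + 1) μ₀) * JpcT L M k - Matrix.diagonal (V k μ₀)‖
      ≤ (d : ℝ) * (Cst d a * Real.sqrt (3 * m) * Real.sqrt ((L : ℝ)⁻¹) ^ k) * (2 * α) := mul_le_mul_of_nonneg_left hEn (by positivity)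
    _ = _ := by ring

/-- **`defect_fdiff_calGlev_le` — THE SECOND DEFECT LETTER**: `‖∇_μ𝒢_k·(J_kᴴ·diag(V^{(k+1)}_{μ₀})·J_k − diag(V^{(k)}_{μ₀}))‖ ≤ d·(Cst√(3m))·2α·(√(L⁻¹))^k` (the same with
`opNorm_fdiff_calGlev_mul_slab_le`). [folklore] -/
theorem defect_fdiff_calGlev_le {α : ℝ} (hα : 0 ≤ α) {m : ℕ} {V : (k : ℕ) → Fin d → (idx L M k → ℂ)} {μ₀ : Fin d} (μ : Fin d)
    (hVb : ∀ k μ u, ‖V k μ u‖ ≤ α) (A : (k : ℕ) → (ν : Fin d) → Finset (ZMod (fine (lev L k) M ν))) (hA : ∀ k ν, (A k ν).card ≤ m)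
    (hdef : ∀ k (u : idx L M k), (∀ ν, u.1 ν ∉ A k ν) →
      ((L : ℂ) ^ d)⁻¹ * ∑ x ∈ univ.filter (fun x : idx L M (k + 1) => parT (lev L k) L M x = u), V (k + 1) μ₀ x = V k μ₀ u) (k : ℕ) :
    ‖fdiff (fine (lev L k) M) ((lev L k : ℕ) : ℂ) μ * calGlev L M a ha k * ((JpcT L M k)ᴴ * Matrix.diagonal (V (k + 1) μ₀) * JpcT L M k - Matrix.diagonal (V k μ₀))‖
      ≤ (d * (Cst d a * Real.sqrt (3 * m)) * (2 * α)) * Real.sqrt ((L : ℝ)⁻¹) ^ k := by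
  have hCst := Cst_nonneg d a
  have hfree := freeTowerLaws_balaban L M a ha
  have hE : (JpcT L M k)ᴴ * Matrix.diagonal (V (k + 1) μ₀) * JpcT L M k - Matrix.diagonal (V k μ₀)
      = Matrix.diagonal (fun u : idx L M k => ((L : ℂ) ^ d)⁻¹ * ∑ x ∈ univ.filter (fun x : idx L M (k + 1) => parT (lev L k) L M x = u), V (k + 1) μ₀ x - V k μ₀ u) := by
    have h1 : (JpcT L M k)ᴴ * Matrix.diagonal (V (k + 1) μ₀) * JpcT L M k
        = Matrix.diagonal (fun u : idx L M k => ((L : ℂ) ^ d)⁻¹ * ∑ x ∈ univ.filter (fun x : idx L M (k + 1) => parT (lev L k) L M x = u), V (k + 1) μ₀ x) :=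
      JK_conjTranspose_mul_diagonal_mul_JK M (lev L k) L (V (k + 1) μ₀)
    rw [h1, Matrix.diagonal_sub]
  have hEn : ‖(JpcT L M k)ᴴ * Matrix.diagonal (V (k + 1) μ₀) * JpcT L M k - Matrix.diagonal (V k μ₀)‖ ≤ 2 * α := by
    refine (norm_sub_le _ _).trans ?_
    have h1 : ‖(JpcT L M k)ᴴ * Matrix.diagonal (V (k + 1) μ₀) * JpcT L M k‖ ≤ α := by
      have hJ := hfree.opNorm_J_le k
      have hJ' : ‖(JpcT L M k)ᴴ‖ ≤ 1 := by rw [Matrix.l2_opNorm_conjTranspose]; exact hJ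
      calc _ ≤ ‖(JpcT L M k)ᴴ * Matrix.diagonal (V (k + 1) μ₀)‖ * ‖JpcT L M k‖ := Matrix.l2_opNorm_mul _ _
        _ ≤ (‖(JpcT L M k)ᴴ‖ * ‖Matrix.diagonal (V (k + 1) μ₀)‖) * 1 := mul_le_mul (Matrix.l2_opNorm_mul _ _) hJ (norm_nonneg _) (mul_nonneg (norm_nonneg _) (norm_nonneg _))
        _ ≤ (1 * α) * 1 := mul_le_mul_of_nonneg_right (mul_le_mul hJ' (opNorm_diagonal_le (fine (lev L (k + 1)) M) hα fun u => hVb (k + 1) μ₀ u) (norm_nonneg _) zero_le_one) zero_le_one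
        _ = α := by ring
    have h2 : ‖Matrix.diagonal (V k μ₀)‖ ≤ α := opNorm_diagonal_le (fine (lev L k) M) hα fun u => hVb k μ₀ u
    linarith
  have hs : ∀ ν, ‖fdiff (fine (lev L k) M) ((lev L k : ℕ) : ℂ) μ * calGlev L M a ha k * Matrix.diagonal (fun w : idx L M k => if w.1 ν ∈ A k ν then (1 : ℂ) else 0)‖
      ≤ Cst d a * Real.sqrt (3 * m) * Real.sqrt ((L : ℝ)⁻¹) ^ k := by
    intro ν
    refine (opNorm_fdiff_calGlev_mul_slab_le L M a ha k μ ν (A k ν)).trans (mul_le_mul_of_nonneg_right (mul_le_mul_of_nonneg_left (Real.sqrt_le_sqrt ?_) hCst) (pow_nonneg (Real.sqrt_nonneg _) k))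
    exact_mod_cast Nat.mul_le_mul_left 3 (hA k ν)
  have he : ∀ w : idx L M k, (((L : ℂ) ^ d)⁻¹ * ∑ x ∈ univ.filter (fun x : idx L M (k + 1) => parT (lev L k) L M x = w), V (k + 1) μ₀ x - V k μ₀ w) ≠ 0 → ∃ ν, w.1 ν ∈ A k ν := by
    intro w hw
    by_contra hne
    exact hw (sub_eq_zero.mpr (hdef k w fun ν hν => hne ⟨ν, hν⟩))
  rw [hE]
  refine (opNorm_mul_diagonal_le_of_slabs M (fdiff (fine (lev L k) M) ((lev L k : ℕ) : ℂ) μ * calGlev L M a ha k) (A k) (by positivity) hs _ he).trans ?_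
  rw [← hE]
  calc (d : ℝ) * (Cst d a * Real.sqrt (3 * m) * Real.sqrt ((L : ℝ)⁻¹) ^ k) * ‖(JpcT L M k)ᴴ * Matrix.diagonal (V (k + 1) μ₀) * JpcT L M k - Matrix.diagonal (V k μ₀)‖
      ≤ (d : ℝ) * (Cst d a * Real.sqrt (3 * m) * Real.sqrt ((L : ℝ)⁻¹) ^ k) * (2 * α) := mul_le_mul_of_nonneg_left hEn (by positivity)
    _ = _ := by ring

end TowerSlab

/-! ## §2 The tower rate of the two-vertex word for almost nested pairs -/

section Tower

variable (M : Fin d → ℕ) [hM : ∀ μ, NeZero (M μ)] (a : ℝ) (ha : 0 < a)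

/-- **`towerLimitRate_almostNestedTwoWord` — THE TWO-VERTEX WORD OF TWO BOUNDED ALMOST NESTED SINGLE-DIRECTION BACKGROUNDS CONVERGES ALONG BAŁABAN's TOWER AT RATIO
`√(L⁻¹)` IN OPERATOR NORM** [our proof] (`L ≥ 2`; `‖Vᵢ‖ ≤ α`, single directions `μ₁, μ₂`; block averages agree with the coarser profiles off `⋃_ν` slabs `Aᵢ,_{k,ν}` with
`#A ≤ m`; EVERY torus) — PART 233 on `freeTowerLaws_balaban` with PART 218's planted letters (rate `L⁻¹ ≤ √(L⁻¹)`) and §1's two defect letters. -/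
theorem towerLimitRate_almostNestedTwoWord (hL : 2 ≤ L) {α : ℝ} (hα : 0 ≤ α) {m : ℕ} {V₁ V₂ : (k : ℕ) → Fin d → (idx L M k → ℂ)} {μ₁ μ₂ : Fin d}
    (hb₁ : ∀ k μ u, ‖V₁ k μ u‖ ≤ α) (hd₁ : ∀ k μ u, μ ≠ μ₁ → V₁ k μ u = 0)
    (A₁ : (k : ℕ) → (ν : Fin d) → Finset (ZMod (fine (lev L k) M ν))) (hA₁ : ∀ k ν, (A₁ k ν).card ≤ m)
    (hdef₁ : ∀ k (u : idx L M k), (∀ ν, u.1 ν ∉ A₁ k ν) →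
      ((L : ℂ) ^ d)⁻¹ * ∑ x ∈ univ.filter (fun x : idx L M (k + 1) => parT (lev L k) L M x = u), V₁ (k + 1) μ₁ x = V₁ k μ₁ u)
    (hb₂ : ∀ k μ u, ‖V₂ k μ u‖ ≤ α) (hd₂ : ∀ k μ u, μ ≠ μ₂ → V₂ k μ u = 0)
    (A₂ : (k : ℕ) → (ν : Fin d) → Finset (ZMod (fine (lev L k) M ν))) (hA₂ : ∀ k ν, (A₂ k ν).card ≤ m)
    (hdef₂ : ∀ k (u : idx L M k), (∀ ν, u.1 ν ∉ A₂ k ν) →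
      ((L : ℂ) ^ d)⁻¹ * ∑ x ∈ univ.filter (fun x : idx L M (k + 1) => parT (lev L k) L M x = u), V₂ (k + 1) μ₂ x = V₂ k μ₂ u) :
    TowerLimitRate (QBlev L M) ((L : ℝ) ^ d) (fun k => calGlev L M a ha k * Pmodel L M V₁ k * (calGlev L M a ha k * Pmodel L M V₂ k * calGlev L M a ha k))
      ((α * Cst d a) * (α * Cst d a) * CJ d a + (Cst d a * α * (α * Cst d a) + Cst d a * α * Cst d a * α) * (CQL d a + 4 * d * Cst d a)
        + Cst d a * α * Cst d a * (d * (Cst d a * Real.sqrt (3 * m)) * (2 * α)) + Cst d a * α * Cst d a * (d * (Cst d a * Real.sqrt (3 * m)) * (2 * α))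
        + (α * Cst d a) * (α * Cst d a) * (d * L * Cst d a) + Cst d a * α * Cst d a * α * (d * L * Cst d a)) (Real.sqrt ((L : ℝ)⁻¹)) := by
  have hL1 : (1 : ℝ) < L := by exact_mod_cast (lt_of_lt_of_le one_lt_two hL : 1 < L)
  have hr : (0 : ℝ) < (L : ℝ) ^ d := pow_pos (lt_trans zero_lt_one hL1) d
  have hρ0 : (0 : ℝ) ≤ (L : ℝ)⁻¹ := inv_nonneg.mpr (Nat.cast_nonneg _)
  have hρ1 : ((L : ℝ)⁻¹) < 1 := inv_lt_one_of_one_lt₀ hL1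
  have hσ1 : Real.sqrt ((L : ℝ)⁻¹) < 1 := by
    rw [show (1 : ℝ) = Real.sqrt 1 from Real.sqrt_one.symm]
    exact Real.sqrt_lt_sqrt hρ0 hρ1
  have hρσ : (L : ℝ)⁻¹ ≤ Real.sqrt ((L : ℝ)⁻¹) := by
    calc (L : ℝ)⁻¹ = Real.sqrt (((L : ℝ)⁻¹) ^ 2) := (Real.sqrt_sq hρ0).symm
      _ ≤ Real.sqrt ((L : ℝ)⁻¹) := Real.sqrt_le_sqrt (by nlinarith)
  have hpow : ∀ k, ((L : ℝ)⁻¹) ^ k ≤ Real.sqrt ((L : ℝ)⁻¹) ^ k := fun k => pow_le_pow_left₀ hρ0 hρσ k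
  have hCst := Cst_nonneg d a
  have hfree := freeTowerLaws_balaban L M a ha
  have hCW0 : 0 ≤ CQL d a + 4 * d * Cst d a :=
    (norm_nonneg _).trans ((plantedW_le_lev L (fun _ : Fin d => 1) a ha 0 μ₁).trans (by rw [pow_zero, mul_one]))
  have hT := towerLimitRate_plantedTwoWordDefect (Δ := calDalev L M a ha) (D₁ := fun k => Matrix.diagonal (V₁ k μ₁)) (D₂ := fun k => Matrix.diagonal (V₂ k μ₂))
    (W₁ := fun k => fdiff (fine (lev L k) M) ((lev L k : ℕ) : ℂ) μ₁ * (calDalev L M a ha k)⁻¹)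
    (W₂ := fun k => fdiff (fine (lev L k) M) ((lev L k : ℕ) : ℂ) μ₂ * (calDalev L M a ha k)⁻¹) hr hfree
    (fun k => by rw [calDalev_inv]; exact opNorm_calG_le (lev L k) (one_le_lev' L k) M a ha)
    (fun k => opNorm_diagonal_le (fine (lev L k) M) hα fun u => hb₁ k μ₁ u)
    (fun k => opNorm_diagonal_le (fine (lev L k) M) hα fun u => hb₂ k μ₂ u)
    (fun k => by rw [calDalev_inv]; exact opNorm_fdiff_calG_le (lev L k) (one_le_lev' L k) M a ha μ₁)
    (fun k => by rw [calDalev_inv]; exact opNorm_fdiff_calG_le (lev L k) (one_le_lev' L k) M a ha μ₂)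
    (fun k => by rw [calDalev_inv, calDalev_inv]; exact plantedG_le_lev L M a ha k)
    (fun k => by rw [calDalev_inv, calDalev_inv]; exact plantedW_le_lev L M a ha k μ₁)
    (fun k => by rw [calDalev_inv, calDalev_inv]; exact plantedW_le_lev L M a ha k μ₂)
    (fun k => by rw [calDalev_inv]; exact defect_calGlev_le L M a ha hα hb₁ A₁ hA₁ hdef₁ k)
    (fun k => by rw [calDalev_inv]; exact defect_fdiff_calGlev_le L M a ha hα μ₁ hb₂ A₂ hA₂ hdef₂ k)
    (fun k => by rw [calDalev_inv]; exact pairingW_le_lev L M a ha k μ₂)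
    hσ1 (fun k => mul_le_mul_of_nonneg_left (hpow k) (CJ_nonneg d a)) (fun k => mul_le_mul_of_nonneg_left (hpow k) hCW0)
    (fun k => le_rfl) (fun k => le_rfl)
    (fun k => mul_le_mul_of_nonneg_left (hpow k) (by positivity)) (fun k => mul_le_mul_of_nonneg_left (hpow k) (by positivity))
  have e : (fun k => (calDalev L M a ha k)⁻¹ * Matrix.diagonal (V₁ k μ₁) * (fdiff (fine (lev L k) M) ((lev L k : ℕ) : ℂ) μ₁ * (calDalev L M a ha k)⁻¹)
      * Matrix.diagonal (V₂ k μ₂) * (fdiff (fine (lev L k) M) ((lev L k : ℕ) : ℂ) μ₂ * (calDalev L M a ha k)⁻¹))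
      = fun k => calGlev L M a ha k * Pmodel L M V₁ k * (calGlev L M a ha k * Pmodel L M V₂ k * calGlev L M a ha k) := by
    funext k; rw [calDalev_inv, Pmodel_single L M hd₁ k, Pmodel_single L M hd₂ k]; simp only [Matrix.mul_assoc]
  rw [e] at hT
  exact hT

/-! ## §3 The three-point level and step envelopes for almost nested bounded pairs, volume-free -/

/-- **`exists_threePoint_twoVertexWord_rate_almostNested` — THE LEVEL AND STEP ENVELOPES OF THE TWO-VERTEX WORD OF TWO BOUNDED, ALMOST NESTED, LOCALISED SINGLE-DIRECTION
BACKGROUNDS, VOLUME-FREE** [our proof] (`L ≥ 2`, `α ≥ 0`, `c₀` arbitrary, `m` layers): `∃ κ > 0, B, B′ ≥ 0` from `(d, L, a, α, c₀, m)` such that on EVERY torus, for all unit bonds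
`i, j`, directions `μ₁, μ₂`, slab families and all families `V₁, V₂` as in §2 supported where `ρ_{k,i} ≤ c₀` resp. `ρ_{k,j} ≤ c₀`, and all `k, x, y`:
`‖X_{[i,j],k}(x,y)‖ ≤ B·e^{−κD}`, `‖(X_{[i,j],k+1} − X_{[i,j],k})(x,y)‖ ≤ B′·(√(√(L⁻¹)))^k·e^{−κD}`, `D = distK(x,i) + distK(i,j) + distK(y,j)`. -/
theorem exists_threePoint_twoVertexWord_rate_almostNested (hL : 2 ≤ L) (α c₀ : ℝ) (hα : 0 ≤ α) (m : ℕ) :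
    ∃ κ B B' : ℝ, 0 < κ ∧ 0 ≤ B ∧ 0 ≤ B' ∧ ∀ (M : Fin d → ℕ) [∀ μ, NeZero (M μ)] (i j : idx L M 0) (μ₁ μ₂ : Fin d) (V₁ V₂ : (k : ℕ) → Fin d → (idx L M k → ℂ))
      (A₁ A₂ : (k : ℕ) → (ν : Fin d) → Finset (ZMod (fine (lev L k) M ν))),
      (∀ k μ u, ‖V₁ k μ u‖ ≤ α) → (∀ k μ u, μ ≠ μ₁ → V₁ k μ u = 0) → (∀ k ν, (A₁ k ν).card ≤ m) →
      (∀ k (u : idx L M k), (∀ ν, u.1 ν ∉ A₁ k ν) →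
        ((L : ℂ) ^ d)⁻¹ * ∑ x ∈ univ.filter (fun x : idx L M (k + 1) => parT (lev L k) L M x = u), V₁ (k + 1) μ₁ x = V₁ k μ₁ u) →
      (∀ k μ u, ‖V₂ k μ u‖ ≤ α) → (∀ k μ u, μ ≠ μ₂ → V₂ k μ u = 0) → (∀ k ν, (A₂ k ν).card ≤ m) →
      (∀ k (u : idx L M k), (∀ ν, u.1 ν ∉ A₂ k ν) →
        ((L : ℂ) ^ d)⁻¹ * ∑ x ∈ univ.filter (fun x : idx L M (k + 1) => parT (lev L k) L M x = u), V₂ (k + 1) μ₂ x = V₂ k μ₂ u) →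
      (∀ k μ u, V₁ k μ u ≠ 0 → rho L M k i u ≤ c₀) → (∀ k μ u, V₂ k μ u ≠ 0 → rho L M k j u ≤ c₀) →
      (∀ k x y, ‖avgTow (QBlev L M) ((L : ℝ) ^ d)
          (fun k => calGlev L M a ha k * Pmodel L M V₁ k * (calGlev L M a ha k * Pmodel L M V₂ k * calGlev L M a ha k)) k x y‖
        ≤ B * Real.exp (-(κ * (distK L M x i + distK L M i j + distK L M y j)))) ∧
      (∀ k x y, ‖(avgTow (QBlev L M) ((L : ℝ) ^ d)
          (fun k => calGlev L M a ha k * Pmodel L M V₁ k * (calGlev L M a ha k * Pmodel L M V₂ k * calGlev L M a ha k)) (k + 1)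
          - avgTow (QBlev L M) ((L : ℝ) ^ d)
          (fun k => calGlev L M a ha k * Pmodel L M V₁ k * (calGlev L M a ha k * Pmodel L M V₂ k * calGlev L M a ha k)) k) x y‖
        ≤ B' * Real.sqrt (Real.sqrt ((L : ℝ)⁻¹)) ^ k * Real.exp (-(κ * (distK L M x i + distK L M i j + distK L M y j)))) := by
  obtain ⟨κ, B, hκ0, hB, hUD⟩ := exists_threePoint_twoVertexWord L a ha α c₀ hα
  set C : ℝ := (α * Cst d a) * (α * Cst d a) * CJ d a + (Cst d a * α * (α * Cst d a) + Cst d a * α * Cst d a * α) * (CQL d a + 4 * d * Cst d a)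
        + Cst d a * α * Cst d a * (d * (Cst d a * Real.sqrt (3 * m)) * (2 * α)) + Cst d a * α * Cst d a * (d * (Cst d a * Real.sqrt (3 * m)) * (2 * α))
        + (α * Cst d a) * (α * Cst d a) * (d * L * Cst d a) + Cst d a * α * Cst d a * α * (d * L * Cst d a) with hCdef
  have hL1 : (1 : ℝ) < L := by exact_mod_cast (lt_of_lt_of_le one_lt_two hL : 1 < L)
  have hρ0 : (0 : ℝ) ≤ (L : ℝ)⁻¹ := inv_nonneg.mpr (Nat.cast_nonneg _)
  have hρ1 : ((L : ℝ)⁻¹) < 1 := inv_lt_one_of_one_lt₀ hL1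
  have hσ0 : 0 ≤ Real.sqrt ((L : ℝ)⁻¹) := Real.sqrt_nonneg _
  have hσ1 : Real.sqrt ((L : ℝ)⁻¹) < 1 := by
    rw [show (1 : ℝ) = Real.sqrt 1 from Real.sqrt_one.symm]
    exact Real.sqrt_lt_sqrt hρ0 hρ1
  have hC0 : 0 ≤ max C 0 := le_max_right _ _
  refine ⟨κ / 2, B, Real.sqrt (2 * B * (2 * (max C 0) / (1 - Real.sqrt ((L : ℝ)⁻¹)))), half_pos hκ0, hB, Real.sqrt_nonneg _,
    fun M _ i j μ₁ μ₂ V₁ V₂ A₁ A₂ hb₁ hd₁ hA₁ hdef₁ hb₂ hd₂ hA₂ hdef₂ hl₁ hl₂ => ?_⟩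
  have hT := towerLimitRate_almostNestedTwoWord L M a ha hL hα hb₁ hd₁ A₁ hA₁ hdef₁ hb₂ hd₂ A₂ hA₂ hdef₂
  have hT' : TowerLimitRate (QBlev L M) ((L : ℝ) ^ d)
      (fun k => calGlev L M a ha k * Pmodel L M V₁ k * (calGlev L M a ha k * Pmodel L M V₂ k * calGlev L M a ha k)) (max C 0) (Real.sqrt ((L : ℝ)⁻¹)) := by
    obtain ⟨Xlim, hlim, hrate⟩ := hT
    refine ⟨Xlim, hlim, fun k => (hrate k).trans ?_⟩
    have h1 : 0 < 1 - Real.sqrt ((L : ℝ)⁻¹) := sub_pos.mpr hσ1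
    exact div_le_div_of_nonneg_right (mul_le_mul_of_nonneg_right (le_max_left _ _) (pow_nonneg hσ0 k)) h1.le
  have hdec : ∀ k, EntryDecay (fun x y => distK L M x i + distK L M i j + distK L M y j)
      (avgTow (QBlev L M) ((L : ℝ) ^ d) (fun k => calGlev L M a ha k * Pmodel L M V₁ k * (calGlev L M a ha k * Pmodel L M V₂ k * calGlev L M a ha k)) k) B κ :=
    fun k x y => hUD M i j V₁ V₂ hb₁ hb₂ hl₁ hl₂ k x y
  obtain ⟨clim, -, -, -, hstep⟩ := decayRate_of_towerLimitRate hσ0 hσ1 hC0 hT' hdec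
  refine ⟨fun k x y => (hUD M i j V₁ V₂ hb₁ hb₂ hl₁ hl₂ k x y).trans (mul_le_mul_of_nonneg_left (Real.exp_le_exp.mpr ?_) hB), fun k x y => hstep k x y⟩
  have h0 : 0 ≤ distK L M x i + distK L M i j + distK L M y j := add_nonneg (add_nonneg (distK_nonneg L M _ _) (distK_nonneg L M _ _)) (distK_nonneg L M _ _)
  nlinarith

end Tower

end Summit.QuantumFields.BalabanUV.Beta.GAN24.AlmostNestedTwoVertexWordRate

end
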